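import Summits.BirchSwinnertonDyer.BirchSwinnertonDyer.Theorems.KatoDescentPotSupersingularZetaBodyRefitUnconditional
import Literature.NumberTheory.EllipticCurves.Kato2004.IwasawaH1CompactSelmer
import HarnessLib

/-!
# Tightness lemma for the rank-ONE residual (K9 `WildRankOne` 19200 / KT `TameRankOne` 19984), PART 21:
# the refit of the tree's Kato zeta data by an ARBITRARY finite-support element `θ̃ = Σ_j α_j τ_j` of the
# integral group ring `ℤ_p[Γ_ℚ]` — unconditional; the bottom class becomes `ε(θ̃) • z_ℚ`
# (`ε` = augmentation), so every `p`-divisibility position of the bottom class is RIGID along the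
# integral refits of unit augmentation and moves along the others

Cell `bsd-potss` (FULL-BSD rank ≤ 1, tranche 1b), seat `bsd-potss-kmc` (descent from Kato's Λ-adic main
conjecture), generation 14, part 21; memo HOME/bsd-potss-kmc/KMC-DESCENT-MEMO-v13.md (census V112).
ROUTE-FREE (no route import); `--supports stmt-BirchSwinnertonDyer-19200`.  Proofs only (no definition:
the refit `θ̃•y := Σ_{j ∈ s} α_j • (τ_j•y)` and the refit functional `Λ^θ̃ := s₀⁻¹ • Σ_{i ∈ s'} β_i • Λ ∘ υ_i`
enter through defining hypotheses `hz'`, `hΛ'`, the levelwise quasi-inverse `η = Σ_i β_i υ_i`,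
`η θ̃ = s₀` on `H¹`, through the displayed hypothesis `hη`).

WHAT THIS SHOWS.  PART 19/20 (`zetaBody_refit`, `zetaBody_refit_unconditional`) treated the two-term
refits `θ = σ̃ + c₀`.  Here `θ̃ = Σ_{j ∈ s} α_j τ_j ∈ ℤ_p[Γ_ℚ]` is ARBITRARY (finite support), subject only to
ADMISSIBILITY = levelwise invertibility over `ℚ_p`, witnessed by integral quasi-inverses
`η_{k,r} = Σ_i β_i υ_i`, `η_{k,r} θ̃ = s₀(k,r) ∈ ℤ_p ∖ {0}` on `H¹(ℚ(μ_m), T_pW)` (`hη`; on a finite abelian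
level this is «`χ(θ̃) ≠ 0` for every character `χ`», the adjugate being integral).  (1) `zetaBody_sumRefit`:
`(κ, Λ, z, x) ↦ (κ, Λ^θ̃, θ̃•z, x)` preserves `Kato2004.ZetaBody` — SAME constant, SAME values, NO further
hypothesis (`IsEulerSystem.sum_smul_conj`, p504399; `Γ_ℚ`-stability of the local clauses, p499306; the
levels are abelian).  (2) `sumRefit_bottom`: the bottom class becomes `ε(θ̃) • z_ℚ`, `ε(θ̃) = Σ_j α_j`.
(3) `divPosition_smul_of_isUnit` / `succ_mem_divPositionSet_prime_smul` (abstract `ℤ_p`-modules): a unit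
scalar fixes `divPosition p B` (the pin quantity `pos` of memo v9–v12), the scalar `p` raises every
admissible exponent.  (4) `divPosition_sumRefit_bottom_of_isUnit`: along every integral refit with
`ε(θ̃) ∈ ℤ_pˣ` the position of the bottom zeta class relative to ANY `ℤ_p`-submodule is unchanged; with
PART 20c (`isUnit_lift_iff_isUnit_aug`, p501982: for `χ` of `p`-power order `χ(θ̃) ∈ 𝒪ˣ ⟺ ε(θ̃) ∈ ℤ_pˣ`)
this is the RIGIDITY of the congruent pin of memo v11 §3 / v12 §5 along the whole integral group ring,
in contrast with the prime-to-`p`-order pins moved by `θ = σ̃ + (p − 1)`.  (5) On a common eigenclass of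
the `τ_j` the refit functional is rescaled by `(Σ α_j ε_j)⁻¹` (`smul_sumRefit_levelFunctional_of_eigen`).
Nothing about BSD is asserted; 19200/19984 stay declared residuals; census row V112 is closed.

References: Rubin, *Euler Systems* (2000) Def. 2.1.1, II §4; PCMI 18 (2011) §4.1 [Rubin2000, Rubin2011];
Kato, Astérisque 295 (2004) (8.1.3), §9.4, Thm. 9.7 [Kato2004Asterisque]; Burns–Kurihara–Sano, JMSJ 76 (2024)
= arXiv:1910.07404, Hyp. 2.2 / (h1) [BurnsKuriharaSano2019]; Serre, *Local Fields* VII §5 [SerreLocalFields1979].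
-/

set_option autoImplicit false
-- the D-0017 layout forces the namespace `Summit.BirchSwinnertonDyer.BirchSwinnertonDyer.…` (repeated component)
set_option linter.dupNamespace false

noncomputable section

open scoped NumberField TensorProduct Pointwise
open Field IsDedekindDomain CongruenceSubgroup
open Literature.NumberTheory.GaloisRepresentations
open Literature.NumberTheory.EllipticCurves Literature.NumberTheory.EllipticCurves.ModularForms
open Literature.NumberTheory.EllipticCurves.Kato2004
open Literature.NumberTheory.EllipticCurves.Kato2004.EulerSystemValues Rat.HeightOneSpectrum

namespace Summit.BirchSwinnertonDyer.BirchSwinnertonDyer.Theorems.ZetaBodyRefit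

/-! ## §1 The refit `θ̃•y = Σ_j α_j • τ_j•y` and its integral quasi-inverse at one level -/

section SumOperators

variable {W : WeierstrassCurve ℚ} [W.IsElliptic] {p : ℕ} [Fact p.Prime]
  [ContinuousSMul ℤ_[p] (W.tateModule p)]
  (U : Subgroup (absoluteGaloisGroup ℚ)) [U.Normal]
  {J : Type*} (s : Finset J) (α : J → ℤ_[p]) (τ : J → absoluteGaloisGroup ℚ)

/-- On an abelian level the Galois transport commutes with every group-ring refit:
`σ•(Σ_j α_j • τ_j•y) = Σ_j α_j • τ_j•(σ•y)`. [cite: SerreLocalFields1979, VII §5 Prop. 3] -/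
theorem conj_sum_smul_conj (hU : commutator (absoluteGaloisGroup ℚ) ≤ U) (σ : absoluteGaloisGroup ℚ)
    (y : H1 (tateRep W p) U) :
    conjMap (tateRep W p).toTopRep U σ 1 (∑ j ∈ s, α j • conjMap (tateRep W p).toTopRep U (τ j) 1 y) =
      ∑ j ∈ s, α j • conjMap (tateRep W p).toTopRep U (τ j) 1 (conjMap (tateRep W p).toTopRep U σ 1 y) := by
  rw [map_sum]
  refine Finset.sum_congr rfl fun j _ ↦ ?_
  rw [map_smul, conj_comm U hU]

/-- **At a level containing every `τ_j` the refit is the SCALAR `ε(θ̃) = Σ_j α_j` (augmentation):**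
`Σ_j α_j • τ_j•y = (Σ_j α_j) • y` — in particular at the bottom level `Γ_ℚ`.
[cite: SerreLocalFields1979, VII §5 Prop. 3] -/
theorem sum_smul_conj_eq_smul_of_mem (hτ : ∀ j ∈ s, τ j ∈ U) (y : H1 (tateRep W p) U) :
    (∑ j ∈ s, α j • conjMap (tateRep W p).toTopRep U (τ j) 1 y) = (∑ j ∈ s, α j) • y := by
  rw [Finset.sum_smul]
  refine Finset.sum_congr rfl fun j hj ↦ ?_
  rw [conj_eq_self_of_mem U (hτ j hj)]

/-- **On a common eigenclass the refit is the scalar `Σ_j α_j ε_j`:** `τ_j•y = ε_j•y` for all `j ∈ s`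
(`ε_j ∈ ℤ_p`, e.g. `y` `χ`-isotypic for a character with values in `ℤ_p`) gives
`Σ_j α_j • τ_j•y = (Σ_j α_j ε_j) • y`. [cite: Rubin2000, Ch. II §4] -/
theorem sum_smul_conj_eq_smul_of_eigen {y : H1 (tateRep W p) U} (ε : J → ℤ_[p])
    (hy : ∀ j ∈ s, conjMap (tateRep W p).toTopRep U (τ j) 1 y = ε j • y) :
    (∑ j ∈ s, α j • conjMap (tateRep W p).toTopRep U (τ j) 1 y) = (∑ j ∈ s, α j * ε j) • y := by
  rw [Finset.sum_smul]
  refine Finset.sum_congr rfl fun j hj ↦ ?_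
  rw [hy j hj, smul_smul]

end SumOperators

/-! ## §2 The refit functional `Λ^θ̃ = s₀⁻¹ • Λ ∘ η` at one level -/

section SumFunctional

variable {W : WeierstrassCurve ℚ} [W.IsElliptic] {p : ℕ} [Fact p.Prime]
  [ContinuousSMul ℤ_[p] (W.tateModule p)]
  (U : Subgroup (absoluteGaloisGroup ℚ)) [U.Normal] {m : ℕ}
  (Λ Λ' : H1 (tateRep W p) U →ₗ[ℤ_[p]] ℚ_[p] ⊗[ℚ] CyclotomicField m ℚ)
  {J : Type*} (s : Finset J) (α : J → ℤ_[p]) (τ : J → absoluteGaloisGroup ℚ)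
  {J' : Type*} (s' : Finset J') (β : J' → ℤ_[p]) (υ : J' → absoluteGaloisGroup ℚ) (s₀ : ℤ_[p])

/-- **The refit functional exists as a `ℤ_p`-linear map:** `Λ^θ̃(y) = s₀⁻¹ • Σ_{i ∈ s'} β_i • Λ(υ_i•y)` — a
`ℚ_p`-combination of `ℤ_p`-linear maps into the `ℚ_p`-space `ℚ_p ⊗ ℚ(ζ_m)` (`ZetaBody` asks no
integrality of its value functionals). [cite: Kato2004Asterisque, §9.4 (p. 188)] -/
theorem exists_sumRefit_functional :
    ∃ Λθ : H1 (tateRep W p) U →ₗ[ℤ_[p]] ℚ_[p] ⊗[ℚ] CyclotomicField m ℚ, ∀ y,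
      Λθ y = ((s₀ : ℤ_[p]) : ℚ_[p])⁻¹ •
        ∑ i ∈ s', β i • Λ (conjMap (tateRep W p).toTopRep U (υ i) 1 y) := by
  refine ⟨((s₀ : ℤ_[p]) : ℚ_[p])⁻¹ • ∑ i ∈ s',
    β i • (Λ ∘ₗ (conjMap (tateRep W p).toTopRep U (υ i) 1).hom.toLinearMap), fun y ↦ ?_⟩
  simp only [LinearMap.smul_apply, LinearMap.coe_sum, Finset.sum_apply, LinearMap.comp_apply]
  rfl

variable {Λ Λ' s α τ s' β υ s₀}
  (hΛ' : ∀ y, Λ' y = ((s₀ : ℤ_[p]) : ℚ_[p])⁻¹ •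
    ∑ i ∈ s', β i • Λ (conjMap (tateRep W p).toTopRep U (υ i) 1 y))
include hΛ'

/-- **`Λ^θ̃ ∘ θ̃ = Λ`:** if `η = Σ_i β_i υ_i` is a quasi-inverse of `θ̃ = Σ_j α_j τ_j` on `H¹(U, T_pW)`
(`η(θ̃•y) = s₀ • y`, `s₀ ≠ 0` in `ℚ_p`), then `Λ^θ̃(θ̃•y) = Λ(y)` — the refit functional absorbs the refit of
the classes ((C4) holds with the SAME value). [cite: Kato2004Asterisque, Thm. 9.7 (p. 189)]
[cite: Rubin2000, Ch. II §4] -/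
theorem sumRefit_functional_refit
    (hη : ∀ y : H1 (tateRep W p) U,
      (∑ i ∈ s', β i • conjMap (tateRep W p).toTopRep U (υ i) 1
        (∑ j ∈ s, α j • conjMap (tateRep W p).toTopRep U (τ j) 1 y)) = s₀ • y)
    (hs₀ : ((s₀ : ℤ_[p]) : ℚ_[p]) ≠ 0) (y : H1 (tateRep W p) U) :
    Λ' (∑ j ∈ s, α j • conjMap (tateRep W p).toTopRep U (τ j) 1 y) = Λ y := by
  rw [hΛ']
  have hsum : (∑ i ∈ s', β i • Λ (conjMap (tateRep W p).toTopRep U (υ i) 1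
        (∑ j ∈ s, α j • conjMap (tateRep W p).toTopRep U (τ j) 1 y))) =
      Λ (∑ i ∈ s', β i • conjMap (tateRep W p).toTopRep U (υ i) 1
        (∑ j ∈ s, α j • conjMap (tateRep W p).toTopRep U (τ j) 1 y)) := by
    simp only [map_sum, map_smul]
  rw [hsum, hη, map_smul, padicInt_smul_eq, smul_smul, inv_mul_cancel₀ hs₀, one_smul]

/-- **On a common eigenclass the refit functional is `(Σ_j α_j ε_j)⁻¹ • Λ`:**
`τ_j•y = ε_j•y (j ∈ s) ⟹ (Σ_j α_j ε_j) • Λ^θ̃(y) = Λ(y)`. [cite: Rubin2000, Ch. II §4]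
[cite: BurnsKuriharaSano2019, Hyp. 2.2 and Remark 2.3] -/
theorem smul_sumRefit_functional_of_eigen
    (hη : ∀ y : H1 (tateRep W p) U,
      (∑ i ∈ s', β i • conjMap (tateRep W p).toTopRep U (υ i) 1
        (∑ j ∈ s, α j • conjMap (tateRep W p).toTopRep U (τ j) 1 y)) = s₀ • y)
    (hs₀ : ((s₀ : ℤ_[p]) : ℚ_[p]) ≠ 0) {y : H1 (tateRep W p) U} (ε : J → ℤ_[p])
    (hy : ∀ j ∈ s, conjMap (tateRep W p).toTopRep U (τ j) 1 y = ε j • y) :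
    (∑ j ∈ s, α j * ε j) • Λ' y = Λ y := by
  rw [← map_smul, ← sum_smul_conj_eq_smul_of_eigen U s α τ ε hy,
    sumRefit_functional_refit U hΛ' hη hs₀]

/-- **(C3a) is transported:** if `Λ(σ•y) = A_σ(Λ y)` for an additive `ℚ_p`-homogeneous `A_σ` (in
`ZetaBody`: `A_σ = 1 ⊗ σ_{χ_m(σ)}`) and `Γ_ℚ/U` is abelian, then `Λ^θ̃(σ•y) = A_σ(Λ^θ̃ y)`.
[cite: Kato2004Asterisque, §9.4 (p. 188)] [cite: SerreLocalFields1979, VII §5] -/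
theorem sumRefit_functional_conj (hU : commutator (absoluteGaloisGroup ℚ) ≤ U) (σ : absoluteGaloisGroup ℚ)
    (Aσ : ℚ_[p] ⊗[ℚ] CyclotomicField m ℚ →+ ℚ_[p] ⊗[ℚ] CyclotomicField m ℚ)
    (hA : ∀ (t : ℚ_[p]) (v : ℚ_[p] ⊗[ℚ] CyclotomicField m ℚ), Aσ (t • v) = t • Aσ v)
    (hΛ : ∀ y : H1 (tateRep W p) U, Λ (conjMap (tateRep W p).toTopRep U σ 1 y) = Aσ (Λ y))
    (y : H1 (tateRep W p) U) :
    Λ' (conjMap (tateRep W p).toTopRep U σ 1 y) = Aσ (Λ' y) := by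
  rw [hΛ', hΛ', hA, map_sum]
  congr 1
  refine Finset.sum_congr rfl fun i _ ↦ ?_
  rw [← conj_comm U hU, hΛ, padicInt_smul_eq, padicInt_smul_eq, hA]

/-- **(C3b) is transported:** if a property `P` of classes (in `ZetaBody`: "all restrictions to the
decomposition groups above `p` vanish") is `Gal`-stable and `Λ` kills the classes with `P`, so does `Λ^θ̃`.
[cite: Kato2004Asterisque, §9.4 (p. 188)] -/
theorem sumRefit_functional_eq_zero_of (P : H1 (tateRep W p) U → Prop)
    (hP : ∀ (σ : absoluteGaloisGroup ℚ) (y : H1 (tateRep W p) U),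
      P y → P (conjMap (tateRep W p).toTopRep U σ 1 y))
    (hΛ : ∀ y : H1 (tateRep W p) U, P y → Λ y = 0) {y : H1 (tateRep W p) U} (hy : P y) :
    Λ' y = 0 := by
  rw [hΛ']
  have h0 : ∀ i ∈ s', β i • Λ (conjMap (tateRep W p).toTopRep U (υ i) 1 y) = 0 := by
    intro i _
    rw [hΛ _ (hP _ y hy), smul_zero]
  rw [Finset.sum_congr rfl h0, Finset.sum_const_zero, smul_zero]

end SumFunctional

/-! ## §3 The refit of a `ZetaBody` datum by `θ̃ ∈ ℤ_p[Γ_ℚ]` — unconditional -/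

section ZetaBodySumRefit

variable {W : WeierstrassCurve ℚ} [W.IsElliptic] {p : ℕ} [Fact p.Prime]
  [ContinuousSMul ℤ_[p] (W.tateModule p)] [Module.Free ℤ_[p] (W.tateModule p)]
  [Module.Finite ℤ_[p] (W.tateModule p)] {N : ℕ} {f : CuspForm (Gamma0 N) 2}
  {ι : (m : ℕ) → (CyclotomicField m ℚ →+* ℂ)} {κ : ℝ}
  {Λ Λ' : ∀ (k : ℕ) (r : Finset (HeightOneSpectrum (𝓞 ℚ))),
    H1 (tateRep W p) (cycSubgroup p k r) →ₗ[ℤ_[p]] ℚ_[p] ⊗[ℚ] CyclotomicField (cycLevel p k r) ℚ}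
  {c d a : ℤ} {A : ℕ}
  {z z' : ∀ (k : ℕ) (r : (cyclotomicLevelsRat p (badPlaces c d A N)).Ideals),
    H1 (tateRep W p) (cycSubgroup p k r.1)}
  {x : ∀ (k : ℕ) (r : (cyclotomicLevelsRat p (badPlaces c d A N)).Ideals),
    CyclotomicField (cycLevel p k r.1) ℚ}
  {J : Type*} {s : Finset J} {α : J → ℤ_[p]} {τ : J → absoluteGaloisGroup ℚ}
  {J' : Type*} {s' : ∀ (k : ℕ) (r : Finset (HeightOneSpectrum (𝓞 ℚ))), Finset J'}
  {β : ∀ (k : ℕ) (r : Finset (HeightOneSpectrum (𝓞 ℚ))), J' → ℤ_[p]}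
  {υ : ∀ (k : ℕ) (r : Finset (HeightOneSpectrum (𝓞 ℚ))), J' → absoluteGaloisGroup ℚ}
  {s₀ : ∀ (k : ℕ) (r : Finset (HeightOneSpectrum (𝓞 ℚ))), ℤ_[p]}
  (hz' : ∀ (k : ℕ) (r : (cyclotomicLevelsRat p (badPlaces c d A N)).Ideals),
    z' k r = ∑ j ∈ s, α j • conjMap (tateRep W p).toTopRep (cycSubgroup p k r.1) (τ j) 1 (z k r))
  (hΛ' : ∀ (k : ℕ) (r : Finset (HeightOneSpectrum (𝓞 ℚ))) (y : H1 (tateRep W p) (cycSubgroup p k r)),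
    Λ' k r y = ((s₀ k r : ℤ_[p]) : ℚ_[p])⁻¹ •
      ∑ i ∈ s' k r, β k r i • Λ k r (conjMap (tateRep W p).toTopRep (cycSubgroup p k r) (υ k r i) 1 y))
  (hη : ∀ (k : ℕ) (r : Finset (HeightOneSpectrum (𝓞 ℚ))) (y : H1 (tateRep W p) (cycSubgroup p k r)),
    (∑ i ∈ s' k r, β k r i • conjMap (tateRep W p).toTopRep (cycSubgroup p k r) (υ k r i) 1
      (∑ j ∈ s, α j • conjMap (tateRep W p).toTopRep (cycSubgroup p k r) (τ j) 1 y)) = s₀ k r • y)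
  (hs₀ : ∀ (k : ℕ) (r : Finset (HeightOneSpectrum (𝓞 ℚ))), ((s₀ k r : ℤ_[p]) : ℚ_[p]) ≠ 0)

include hz' hΛ' hη hs₀ in
/-- **REFIT OF THE ZETA DATA BY AN ARBITRARY ADMISSIBLE `θ̃ ∈ ℤ_p[Γ_ℚ]` — UNCONDITIONAL (PART 21).**
Let `(κ, Λ, z, x)` satisfy `ZetaBody W p f ι κ Λ c d a A z x`; let `θ̃ = Σ_{j ∈ s} α_j τ_j` (`α_j ∈ ℤ_p`,
`τ_j ∈ Γ_ℚ`) be ADMISSIBLE: at every level `(k, r)` an integral quasi-inverse `η_{k,r} = Σ_{i ∈ s'} β_i υ_i`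
with `η_{k,r}(θ̃•y) = s₀(k,r) • y` on `H¹(ℚ(μ_m), T_pW)`, `s₀(k,r) ≠ 0` in `ℚ_p` (`hη`, `hs₀`); let
`z' = θ̃•z` (`hz'`) and `Λ' = Λ^θ̃ = s₀⁻¹ • Λ ∘ η` (`hΛ'`).  Then `(κ, Λ^θ̃, θ̃•z, x)` satisfies `ZetaBody`:
SAME `κ`, SAME values `x`, NO further hypothesis.  (`θ = σ̃ + c₀` of PART 19/20 is the case `s = {σ̃, 1}`,
`η = Σ_{i<n} (−c₀)^i σ̃^{n−1−i}`, `s₀ = 1 − (−c₀)^n`.)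
[cite: Kato2004Asterisque, (8.1.3) (p. 180), §9.4 (p. 188), Thm. 9.7 (p. 189), Thm. 6.6 (1) (p. 163)]
[cite: Rubin2011, §4.1] [cite: Rubin2000, Def. 2.1.1] -/
theorem zetaBody_sumRefit (h : ZetaBody W p f ι κ Λ c d a A z x) :
    ZetaBody W p f ι κ Λ' c d a A z' x := by
  obtain ⟨h1, h2, h3a, h3b, h4, h5⟩ := h
  refine ⟨?_, ?_, ?_, ?_, ?_, h5⟩
  · -- (C1): `θ̃•z` is an Euler system — `ES(T)` is a `ℤ_p[Γ_ℚ]`-module in finite-support form (p504399)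
    exact h1.sum_smul_conj (cyclotomicLevelsRat p (badPlaces c d A N)) (tateRep W p) p s α τ hz'
  · -- (C2): `θ̃•z` is unramified away from `p` — restriction is additive and "unramified at `v`" is
    -- `Γ_ℚ`-stable (`forall_resLe_inf_inertia_conjMap_eq_zero`, p499306)
    intro k r v hv
    have h2' : ∀ 𝔓 ∈ v.primesAbove, resLe (tateRep W p).toTopRep
        (inf_le_left : cycSubgroup p k r.1 ⊓ 𝔓.inertia (absoluteGaloisGroup ℚ) ≤ cycSubgroup p k r.1)
        1 (z k r) = 0 := fun 𝔓 h𝔓 ↦ h2 k r v hv 𝔓 h𝔓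
    intro 𝔓 h𝔓
    change resLe (tateRep W p).toTopRep
        (inf_le_left : cycSubgroup p k r.1 ⊓ 𝔓.inertia (absoluteGaloisGroup ℚ) ≤ cycSubgroup p k r.1)
        1 (z' k r) = 0
    rw [hz' k r, map_sum]
    refine Finset.sum_eq_zero fun j _ ↦ ?_
    rw [map_smul, forall_resLe_inf_inertia_conjMap_eq_zero (tateRep W p).toTopRep _ v (τ j) h2' 𝔓 h𝔓,
      smul_zero]
  · -- (C3a): equivariance transported (`Gal(ℚ(μ_m)/ℚ)` abelian, so `η` commutes with `σ`)
    intro k r σ y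
    have hcomm := (cyclotomicLevelsRat p (∅ : Set (HeightOneSpectrum (𝓞 ℚ)))).commutator_le_level k r
    exact sumRefit_functional_conj (cycSubgroup p k r) (hΛ' k r) hcomm σ
      (Algebra.TensorProduct.map (AlgHom.id ℚ ℚ_[p])
        (sigma (cycLevel p k r) (modNCyclotomicCharacter ℚ (cycLevel p k r) σ) :
          CyclotomicField (cycLevel p k r) ℚ →ₐ[ℚ] CyclotomicField (cycLevel p k r) ℚ)).toAddMonoidHom
      (fun t v ↦ ZetaBodyScaling.map_id_smul _ t v) (fun y' ↦ h3a k r σ y') y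
  · -- (C3b): locality transported (local triviality above `p` is `Gal`-stable, PART 20)
    intro k r y hy
    exact sumRefit_functional_eq_zero_of (cycSubgroup p k r) (hΛ' k r) _
      (fun σ y' hy' ↦ local_triviality_conj_stable k r σ y' hy') (h3b k r) hy
  · -- (C4): `Λ^θ̃(θ̃•z) = Λ(z) = 1 ⊗ x`
    intro k r
    rw [hz' k r]
    exact (sumRefit_functional_refit (cycSubgroup p k r.1) (hΛ' k r.1) (hη k r.1) (hs₀ k r.1)
      (z k r)).trans (h4 k r)

omit [Module.Free ℤ_[p] (W.tateModule p)] [Module.Finite ℤ_[p] (W.tateModule p)] in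
include hz' in
/-- **At the bottom level the refit is the AUGMENTATION:** `(θ̃•z)_ℚ = ε(θ̃) • z_ℚ`, `ε(θ̃) = Σ_j α_j`
(every `τ_j` lies in `Gal(ℚ̄/ℚ(μ_1)) = Γ_ℚ`).  So every `ℤ_p`-valued position invariant of the bottom class
is unchanged when `ε(θ̃) ∈ ℤ_pˣ` and moves by `v_p(ε(θ̃))` in general (§4).
[cite: SerreLocalFields1979, VII §5 Prop. 3] [cite: BurnsKuriharaSano2019, Hyp. 2.2 and (h1) (p. 9)] -/
theorem sumRefit_bottom :
    z' 0 (cyclotomicLevelsRat p (badPlaces c d A N)).idealOne =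
      (∑ j ∈ s, α j) • z 0 (cyclotomicLevelsRat p (badPlaces c d A N)).idealOne := by
  rw [hz']
  exact sum_smul_conj_eq_smul_of_mem _ s α τ
    (fun j _ ↦ (cyclotomicLevelsRat p (∅ : Set (HeightOneSpectrum (𝓞 ℚ)))).top_le_level_bot_empty
      (Subgroup.mem_top (τ j))) _

omit [Module.Free ℤ_[p] (W.tateModule p)] [Module.Finite ℤ_[p] (W.tateModule p)] in
include hΛ' hη hs₀ in
/-- **On a common eigenclass of the `τ_j` at level `(k, r)` the refit functional is
`(Σ_j α_j ε_j)⁻¹ • Λ_{k,r}`:** `(Σ_j α_j ε_j) • Λ^θ̃_{k,r}(y) = Λ_{k,r}(y)` whenever `τ_j•y = ε_j•y` for all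
`j ∈ s` (`ε_j ∈ ℤ_p`: characters of order dividing `p − 1`).  So a single-character pin with an
EXISTENTIAL image exponent is carried along every admissible integral refit; only an EXPLICIT exponent at
a character `≡ 𝟙 (mod 𝔭)` ties the refit to the augmentation (PART 20c `isUnit_lift_iff_isUnit_aug`).
[cite: Rubin2000, Ch. II §4] [cite: BurnsKuriharaSano2019, Hyp. 2.2 and Remark 2.3 (p. 9)] -/
theorem smul_sumRefit_levelFunctional_of_eigen (k : ℕ) (r : Finset (HeightOneSpectrum (𝓞 ℚ)))
    {y : H1 (tateRep W p) (cycSubgroup p k r)} (ε : J → ℤ_[p])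
    (hy : ∀ j ∈ s, conjMap (tateRep W p).toTopRep (cycSubgroup p k r) (τ j) 1 y = ε j • y) :
    (∑ j ∈ s, α j * ε j) • Λ' k r y = Λ k r y :=
  smul_sumRefit_functional_of_eigen _ (hΛ' k r) (hη k r) (hs₀ k r) ε hy

end ZetaBodySumRefit

/-! ## §4 The `p`-divisibility position under scalars (abstract `ℤ_p`-modules) -/

section Position

variable {p : ℕ} [Fact p.Prime] {M : Type*} [AddCommGroup M] [Module ℤ_[p] M]
  (B : Submodule ℤ_[p] M)

/-- A scalar multiple of an element of finite additive order has finite additive order. [folklore] -/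
theorem isOfFinAddOrder_smul (u : ℤ_[p]) {t : M} (ht : IsOfFinAddOrder t) : IsOfFinAddOrder (u • t) := by
  rw [isOfFinAddOrder_iff_nsmul_eq_zero] at ht ⊢
  obtain ⟨n, hn, hnt⟩ := ht
  exact ⟨n, hn, by rw [smul_comm, hnt, smul_zero]⟩

/-- Scalars act on the admissible exponents: `k ∈ pos-set(y) ⟹ k ∈ pos-set(u • y)` for a `ℤ_p`-SUBMODULE
`B` (`y = p^k b + t ⟹ u•y = p^k (u•b) + u•t`). [cite: BurnsKuriharaSano2019, Hyp. 2.2 and (h1) (p. 9)] -/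
theorem mem_divPositionSet_smul (u : ℤ_[p]) {y : M} {k : ℕ}
    (hk : k ∈ divPositionSet p B.toAddSubgroup y) : k ∈ divPositionSet p B.toAddSubgroup (u • y) := by
  obtain ⟨b, hb, t, ht, hfin, hy⟩ := hk
  refine ⟨u • b, B.smul_mem u hb, u • t, B.smul_mem u ht, isOfFinAddOrder_smul u hfin, ?_⟩
  rw [hy, smul_add, smul_comm]

/-- **A UNIT scalar fixes the set of admissible exponents.** [cite: BurnsKuriharaSano2019, (h1) (p. 9)] -/
theorem divPositionSet_smul_of_isUnit {u : ℤ_[p]} (hu : IsUnit u) (y : M) :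
    divPositionSet p B.toAddSubgroup (u • y) = divPositionSet p B.toAddSubgroup y := by
  ext k
  refine ⟨fun hk ↦ ?_, mem_divPositionSet_smul B u⟩
  obtain ⟨v, rfl⟩ := hu
  have h := mem_divPositionSet_smul B ((v⁻¹ : ℤ_[p]ˣ) : ℤ_[p]) hk
  rwa [smul_smul, Units.inv_mul, one_smul] at h

/-- **A UNIT scalar fixes the `p`-divisibility position** `divPosition p B` (the pin quantity `pos` of
memo v9–v12 of the seat). [cite: BurnsKuriharaSano2019, Hyp. 2.2 and (h1) (p. 9), Thm. 1.4 (p. 4)] -/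
theorem divPosition_smul_of_isUnit {u : ℤ_[p]} (hu : IsUnit u) (y : M) :
    divPosition p B.toAddSubgroup (u • y) = divPosition p B.toAddSubgroup y := by
  rw [divPosition, divPosition, divPositionSet_smul_of_isUnit B hu y]

/-- **The scalar `p` raises every admissible exponent by one:** `k ∈ pos-set(y) ⟹ k + 1 ∈ pos-set(p • y)`.
So an admissible integral refit of augmentation `p·(unit)` (PART 20: `θ = σ̃ + (p − 1)`) shifts the
position of a class of bounded position. [cite: BurnsKuriharaSano2019, Hyp. 2.2 and (h1) (p. 9)] -/
theorem succ_mem_divPositionSet_prime_smul {y : M} {k : ℕ} (hk : k ∈ divPositionSet p B.toAddSubgroup y) :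
    k + 1 ∈ divPositionSet p B.toAddSubgroup ((p : ℤ_[p]) • y) := by
  obtain ⟨b, hb, t, ht, hfin, hy⟩ := hk
  refine ⟨b, hb, (p : ℤ_[p]) • t, B.smul_mem _ ht, isOfFinAddOrder_smul _ hfin, ?_⟩
  rw [hy, smul_add, pow_succ, mul_comm, ← smul_smul, Nat.cast_smul_eq_nsmul ℤ_[p]]

end Position

/-! ## §5 Rigidity of the bottom position along integral refits of unit augmentation -/

section Rigidity

variable {W : WeierstrassCurve ℚ} [W.IsElliptic] {p : ℕ} [Fact p.Prime]
  [ContinuousSMul ℤ_[p] (W.tateModule p)] {N : ℕ} {c d a : ℤ} {A : ℕ}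
  {z z' : ∀ (k : ℕ) (r : (cyclotomicLevelsRat p (badPlaces c d A N)).Ideals),
    H1 (tateRep W p) (cycSubgroup p k r.1)}
  {J : Type*} {s : Finset J} {α : J → ℤ_[p]} {τ : J → absoluteGaloisGroup ℚ}
  (hz' : ∀ (k : ℕ) (r : (cyclotomicLevelsRat p (badPlaces c d A N)).Ideals),
    z' k r = ∑ j ∈ s, α j • conjMap (tateRep W p).toTopRep (cycSubgroup p k r.1) (τ j) 1 (z k r))

include hz' in
/-- **RIGIDITY OF THE BOTTOM POSITION ALONG THE INTEGRAL GROUP RING.**  For every finite-support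
`θ̃ = Σ_j α_j τ_j ∈ ℤ_p[Γ_ℚ]` with UNIT augmentation `ε(θ̃) = Σ_j α_j ∈ ℤ_pˣ` and every `ℤ_p`-submodule `B`
of `H¹(ℚ, T_pW)` (intended: the finite classes `H¹_f`, or the saturation of `ℤ_p z_ℚ`), the
`p`-divisibility position of the bottom class is unchanged: `pos_B((θ̃•z)_ℚ) = pos_B(z_ℚ)`.  With PART 20c
(`isUnit_lift_iff_isUnit_aug`: for a character `χ` of `p`-power order, `χ(θ̃) ∈ 𝒪ˣ ⟺ ε(θ̃) ∈ ℤ_pˣ`) this is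
the refit-rigidity of the congruent pin of memo v11 §3 along every `χ`-admissible integral refit — in
contrast with the prime-to-`p`-order pins moved by PART 19/20.  Nothing is asserted about which refits
are `ZetaBody`-admissible (§3 treats that) nor about BSD.
[cite: BurnsKuriharaSano2019, Hyp. 2.2 and (h1) (p. 9)] [cite: Rubin2011, §4.1] -/
theorem divPosition_sumRefit_bottom_of_isUnit (hε : IsUnit (∑ j ∈ s, α j))
    (B : Submodule ℤ_[p] (H1 (tateRep W p) (cycSubgroup p 0 ∅))) :
    divPosition p B.toAddSubgroup (z' 0 (cyclotomicLevelsRat p (badPlaces c d A N)).idealOne) =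
      divPosition p B.toAddSubgroup (z 0 (cyclotomicLevelsRat p (badPlaces c d A N)).idealOne) := by
  rw [sumRefit_bottom hz']
  exact divPosition_smul_of_isUnit B hε _

include hz' in
/-- **… and augmentation `p` shifts it:** if `ε(θ̃) = p` then every admissible exponent `k` of `z_ℚ`
relative to `B` gives the admissible exponent `k + 1` of `(θ̃•z)_ℚ` (PART 20's `θ = σ̃ + (p − 1)` is the
case `s = {σ̃, 1}`). [cite: BurnsKuriharaSano2019, Hyp. 2.2 and (h1) (p. 9)] -/
theorem succ_mem_divPositionSet_sumRefit_bottom (hε : (∑ j ∈ s, α j) = (p : ℤ_[p]))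
    (B : Submodule ℤ_[p] (H1 (tateRep W p) (cycSubgroup p 0 ∅))) {k : ℕ}
    (hk : k ∈ divPositionSet p B.toAddSubgroup (z 0 (cyclotomicLevelsRat p (badPlaces c d A N)).idealOne)) :
    k + 1 ∈ divPositionSet p B.toAddSubgroup (z' 0 (cyclotomicLevelsRat p (badPlaces c d A N)).idealOne) := by
  rw [sumRefit_bottom hz', hε]
  exact succ_mem_divPositionSet_prime_smul B hk

end Rigidity

end Summit.BirchSwinnertonDyer.BirchSwinnertonDyer.Theorems.ZetaBodyRefit

end
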